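import Summits.NavierStokesRegularity.TurbBounds.ShearSpecPieces
import Summits.NavierStokesRegularity.TurbBounds.PieceAssembly
import Summits.NavierStokesRegularity.TurbBounds.Certs.S1000.Scalars
import Summits.NavierStokesRegularity.TurbBounds.Certs.S1000.EvalPieces1p1
import Summits.NavierStokesRegularity.TurbBounds.Certs.S1000.EvalPieces1p2
import Summits.NavierStokesRegularity.TurbBounds.Certs.S1000.EvalPieces1p3
import Summits.NavierStokesRegularity.TurbBounds.Certs.S1000.SpecPieces1c1
import HarnessLib

/-!
# Row S1000 — mode 1 (part 3/6: Qphi6, Qphi7, Qphi8, Qphi9): the literal evaluator pieces ARE the SPEC 2.8 rule (generator C, kernel)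

Container `C1p-fw16-Gx2-Gr1000-P20-N16-j110919` (rbcert.json sha256 15211248adbb023f…; piece dump `blocks_A.rbsdp-blocks0.json.gz` sha256 7e6f3737c61f1cab…), family fw16_shear_2d,
`Γx = 2`, `P = 20`, mode `m = 1`, truncation `N_m = 16`, `dim = 2(N+P+3) = 78`. For each piece X ∈ {Q0, QT, Qφ⁽⁰⁾…Qφ⁽20⁾} of rbsdp SPEC 2.8 the theorem
`X_1_spec : densify 78 X_1_js X_1_vs = <ShearSpecPieces rule at (N, P, m, Γx, π_lo, π_hi)>` holds by `decide +kernel`: the literal sparse rows of the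
landed `EvalPieces1*` files (generator A dump, A/B-agreed) coincide entry for entry with the rule of `TurbBounds/ShearSpecPieces.lean` — a third,
independent transcription of SPEC §1–§2 evaluated in the kernel. With the landed `EvalBlock1.eval_rule` (`B001.A = den • (Q0 + Σ φ̂_p Qφ⁽ᵖ⁾ + T·QT)`)
this closes the algebraic part of SPEC 2.8 for this mode in the kernel: `Cn = den · Q_m(φ̂, T)` with `Q_m` COMPUTED FROM THE FORMULAS. Not in the kernel:
that the formulas are the Legendre–Galerkin matrices of FW16 (4.13)–(4.15) (bridge, v2), the tail lemma at function level, the cited reduction.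
pub-turb-shear gen 6 (generator lean-t12/specpieces/gen_specpieces.py). HONEST FRAMING: rigorous bounds for the stated PDE and boundary conditions; no claim about physical turbulence beyond the bound.
-/

set_option linter.style.longLine false
set_option maxRecDepth 100000

namespace Summit.NavierStokesRegularity.TurbBounds.Certs.S1000.SpecPieces.M1

open Summit.NavierStokesRegularity.TurbBounds.ShearSpecPieces Summit.NavierStokesRegularity.TurbBounds.PieceAssembly Summit.NavierStokesRegularity.TurbBounds.Certs.S1000.Eval

set_option maxHeartbeats 0 in
/-- **`Qφ⁽6⁾` piece = SPEC rule** (`D = D_1`, `E⁽6⁾ = D0cᵀK⁽6⁾D1`). -/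
theorem Qphi6_1_spec : densify 78 Qphi6_1_js Qphi6_1_vs = qphiPiece N P (Dm S1000.Scalars.Gx S1000.Scalars.piLo 1) 6 := by decide +kernel

set_option maxHeartbeats 0 in
/-- **`Qφ⁽7⁾` piece = SPEC rule** (`D = D_1`, `E⁽7⁾ = D0cᵀK⁽7⁾D1`). -/
theorem Qphi7_1_spec : densify 78 Qphi7_1_js Qphi7_1_vs = qphiPiece N P (Dm S1000.Scalars.Gx S1000.Scalars.piLo 1) 7 := by decide +kernel

set_option maxHeartbeats 0 in
/-- **`Qφ⁽8⁾` piece = SPEC rule** (`D = D_1`, `E⁽8⁾ = D0cᵀK⁽8⁾D1`). -/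
theorem Qphi8_1_spec : densify 78 Qphi8_1_js Qphi8_1_vs = qphiPiece N P (Dm S1000.Scalars.Gx S1000.Scalars.piLo 1) 8 := by decide +kernel

set_option maxHeartbeats 0 in
/-- **`Qφ⁽9⁾` piece = SPEC rule** (`D = D_1`, `E⁽9⁾ = D0cᵀK⁽9⁾D1`). -/
theorem Qphi9_1_spec : densify 78 Qphi9_1_js Qphi9_1_vs = qphiPiece N P (Dm S1000.Scalars.Gx S1000.Scalars.piLo 1) 9 := by decide +kernel

end Summit.NavierStokesRegularity.TurbBounds.Certs.S1000.SpecPieces.M1
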